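import Mathlib

/-!
# TOT2-LINE (P3) brick B6-comparison: the GENERIC BUDGET COMPARISON along an injection of branch sets

Sub-problem `ResolutionOfSingularities`, ENGINE crux `stmt-ResolutionOfSingularities-8899` (`LocalWeightedDrop`), skeleton v35 (2e806da509994632),
registered stub `stub_conflictBudget` (P3); design `L/res-L1-w43-stub-2/g6/CONFLICT-BUDGET-DESIGN-v1.md` §3 («SUMMING»).  [OURS · L1 W4.3 · chain w43 ·
res-L1-w43-stub-2 g6 (owner of (P3)); def-free, Mathlib-only; pure finite-sum algebra — the combinatorial skeleton of the B6 glue: every step theorem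
(`u₁`-origin, translated point, `u₂`-origin, the two curve moves, the graph move) is this lemma applied to the injection `P′ ↦ Φ⁻¹P′` of B4 with
the per-branch inequalities of the transport table (B3/B5, the `row_*` lemmas of split v1).  Nothing here is a statement of any manuscript;
AI-produced, gate-checked, weaker than expert review.]

Shape of a budget: `M = Σ_{P ∈ S} c P + 2·Σ_{P ∈ S} Σ_{Q ∈ S ∖ {P}} q P Q` (charges + ordered pair terms, twice).  Upstairs the same with
`S′, c′, q′`; an injection `ι : S′ ↪ S` (every surviving branch comes from one below).  The branches of `S` outside the image are DYING (they do
not pass through the new point, or became coordinate lines): their charges are FREED and their pair terms with a surviving branch may PAY that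
branch's births.  Hypotheses: surviving pairs do not increase (`hq`); each surviving branch's new charge plus a slack is bounded by its old charge
plus twice its pair terms with the dying branches (`hc`).  Conclusion (`budget_comparison`):
`M′ + Σ slack + Σ_{dying} c ≤ M` — so `M′ ≤ M`, and `M′ < M` as soon as one slack or one dying charge is positive
(`budget_lt_of_slack`, `budget_lt_of_dying`).
-/

set_option linter.dupNamespace false -- mandated namespace of this single-conjunct summit

namespace Summit.ResolutionOfSingularities.ResolutionOfSingularities.Theorems

namespace TOT2Branch

open Finset

variable {α β : Type*} [DecidableEq α] [DecidableEq β]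

omit [DecidableEq β] in
/-- The DYING elements: those of `S` outside the image of `S′`. -/
theorem mem_filter_not_mem_image {S : Finset α} {S' : Finset β} {ι : β → α} {Q : α} :
    Q ∈ S.filter (fun Q => Q ∉ S'.image ι) ↔ Q ∈ S ∧ ∀ P' ∈ S', ι P' ≠ Q := by
  simp only [mem_filter, mem_image, not_exists, not_and]

/-- **THE GENERIC BUDGET COMPARISON.**  See the module docstring. -/
theorem budget_comparison (S' : Finset β) (S : Finset α) (ι : β → α) (hι : ∀ P' ∈ S', ι P' ∈ S) (hinj : Set.InjOn ι S')
    (c' s : β → ℕ) (c : α → ℕ) (q' : β → β → ℕ) (q : α → α → ℕ)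
    (hq : ∀ P' ∈ S', ∀ Q' ∈ S', P' ≠ Q' → q' P' Q' ≤ q (ι P') (ι Q'))
    (hc : ∀ P' ∈ S', c' P' + s P' ≤ c (ι P') + 2 * ∑ Q ∈ S.filter (fun Q => Q ∉ S'.image ι), (q (ι P') Q + q Q (ι P'))) :
    (∑ P' ∈ S', c' P') + 2 * (∑ P' ∈ S', ∑ Q' ∈ S'.erase P', q' P' Q') + (∑ P' ∈ S', s P') +
        ∑ Q ∈ S.filter (fun Q => Q ∉ S'.image ι), c Q ≤
      (∑ P ∈ S, c P) + 2 * ∑ P ∈ S, ∑ Q ∈ S.erase P, q P Q := by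
  set D := S.filter (fun Q => Q ∉ S'.image ι) with hDdef
  set I := S'.image ι with hIdef
  have hIS : I ⊆ S := fun x hx => by
    obtain ⟨P', hP', rfl⟩ := mem_image.mp hx; exact hι P' hP'
  have hDS : D ⊆ S := filter_subset _ _
  have hdisj : Disjoint I D := by
    rw [Finset.disjoint_left]
    intro x hxI hxD
    exact (mem_filter.mp hxD).2 hxI
  have hS : S = I ∪ D := by
    ext x
    simp only [mem_union, hDdef, mem_filter, hIdef]
    tauto
  have hinj' : ∀ x ∈ S', ∀ y ∈ S', ι x = ι y → x = y := fun x hx y hy h => hinj hx hy h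
  -- charges: `Σ_S c = Σ_{S'} c ∘ ι + Σ_D c`
  have hcharge : ∑ P ∈ S, c P = (∑ P' ∈ S', c (ι P')) + ∑ Q ∈ D, c Q := by
    rw [hS, sum_union hdisj, hIdef, sum_image hinj']
  -- pairs, image part: for each `P'`, the inner sum over `S ∖ {ι P'}` dominates the surviving pairs and the dying partners
  have hpair1 : ∀ P' ∈ S', (∑ Q' ∈ S'.erase P', q (ι P') (ι Q')) + ∑ Q ∈ D, q (ι P') Q ≤ ∑ Q ∈ S.erase (ι P'), q (ι P') Q := by
    intro P' hP'
    have hsub : (S'.erase P').image ι ∪ D ⊆ S.erase (ι P') := by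
      intro x hx
      rcases mem_union.mp hx with hx | hx
      · obtain ⟨Q', hQ', rfl⟩ := mem_image.mp hx
        have hQ'S : Q' ∈ S' := mem_of_mem_erase hQ'
        refine mem_erase.mpr ⟨fun h => (ne_of_mem_erase hQ') (hinj hQ'S hP' h), hι Q' hQ'S⟩
      · refine mem_erase.mpr ⟨fun h => ?_, hDS hx⟩
        exact (mem_filter.mp hx).2 (mem_image.mpr ⟨P', hP', h.symm⟩)
    have hdisj1 : Disjoint ((S'.erase P').image ι) D := by
      rw [Finset.disjoint_left]
      intro x hxI hxD
      obtain ⟨Q', hQ', rfl⟩ := mem_image.mp hxI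
      exact (mem_filter.mp hxD).2 (mem_image.mpr ⟨Q', mem_of_mem_erase hQ', rfl⟩)
    have hinj1 : ∀ x ∈ S'.erase P', ∀ y ∈ S'.erase P', ι x = ι y → x = y :=
      fun x hx y hy h => hinj (mem_of_mem_erase hx) (mem_of_mem_erase hy) h
    calc (∑ Q' ∈ S'.erase P', q (ι P') (ι Q')) + ∑ Q ∈ D, q (ι P') Q
        = ∑ Q ∈ (S'.erase P').image ι ∪ D, q (ι P') Q := by rw [sum_union hdisj1, sum_image hinj1]
      _ ≤ ∑ Q ∈ S.erase (ι P'), q (ι P') Q := sum_le_sum_of_subset_of_nonneg hsub fun _ _ _ => Nat.zero_le _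
  -- pairs, dying part: each dying `Q` pairs with every surviving image
  have hpair2 : ∀ Q ∈ D, ∑ P' ∈ S', q Q (ι P') ≤ ∑ P ∈ S.erase Q, q Q P := by
    intro Q hQ
    have hsub : S'.image ι ⊆ S.erase Q := by
      intro x hx
      obtain ⟨P', hP', rfl⟩ := mem_image.mp hx
      exact mem_erase.mpr ⟨fun h => (mem_filter.mp hQ).2 (mem_image.mpr ⟨P', hP', h⟩), hι P' hP'⟩
    calc ∑ P' ∈ S', q Q (ι P') = ∑ P ∈ S'.image ι, q Q P := (sum_image hinj').symm
      _ ≤ ∑ P ∈ S.erase Q, q Q P := sum_le_sum_of_subset_of_nonneg hsub fun _ _ _ => Nat.zero_le _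
  -- assemble the pair inequality
  have hpairs : (∑ P' ∈ S', ∑ Q' ∈ S'.erase P', q (ι P') (ι Q')) + ∑ P' ∈ S', ∑ Q ∈ D, (q (ι P') Q + q Q (ι P')) ≤
      ∑ P ∈ S, ∑ Q ∈ S.erase P, q P Q := by
    have h1 : ∑ P' ∈ S', ∑ Q ∈ D, (q (ι P') Q + q Q (ι P')) =
        (∑ P' ∈ S', ∑ Q ∈ D, q (ι P') Q) + ∑ Q ∈ D, ∑ P' ∈ S', q Q (ι P') := by
      rw [sum_comm (s := D) (t := S'), ← sum_add_distrib]
      refine sum_congr rfl fun P' _ => sum_add_distrib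
    rw [h1, hS, sum_union hdisj, hIdef, sum_image hinj', ← hIdef, ← hS]
    have hA : (∑ P' ∈ S', ∑ Q' ∈ S'.erase P', q (ι P') (ι Q')) + ∑ P' ∈ S', ∑ Q ∈ D, q (ι P') Q ≤
        ∑ P' ∈ S', ∑ Q ∈ S.erase (ι P'), q (ι P') Q := by
      rw [← sum_add_distrib]; exact sum_le_sum hpair1
    have hB : ∑ Q ∈ D, ∑ P' ∈ S', q Q (ι P') ≤ ∑ Q ∈ D, ∑ P ∈ S.erase Q, q Q P := sum_le_sum hpair2
    omega
  -- surviving pairs do not increase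
  have hq' : ∑ P' ∈ S', ∑ Q' ∈ S'.erase P', q' P' Q' ≤ ∑ P' ∈ S', ∑ Q' ∈ S'.erase P', q (ι P') (ι Q') :=
    sum_le_sum fun P' hP' => sum_le_sum fun Q' hQ' => hq P' hP' Q' (mem_of_mem_erase hQ') (ne_of_mem_erase hQ').symm
  -- charges with slack
  have hc' : (∑ P' ∈ S', c' P') + ∑ P' ∈ S', s P' ≤ (∑ P' ∈ S', c (ι P')) + 2 * ∑ P' ∈ S', ∑ Q ∈ D, (q (ι P') Q + q Q (ι P')) := by
    rw [← sum_add_distrib, mul_sum, ← sum_add_distrib]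
    exact sum_le_sum hc
  rw [hcharge]
  omega

/-- **STRICT COMPARISON FROM A SLACK**: if some surviving branch has positive slack, the budget drops. -/
theorem budget_lt_of_slack (S' : Finset β) (S : Finset α) (ι : β → α) (hι : ∀ P' ∈ S', ι P' ∈ S) (hinj : Set.InjOn ι S')
    (c' s : β → ℕ) (c : α → ℕ) (q' : β → β → ℕ) (q : α → α → ℕ)
    (hq : ∀ P' ∈ S', ∀ Q' ∈ S', P' ≠ Q' → q' P' Q' ≤ q (ι P') (ι Q'))
    (hc : ∀ P' ∈ S', c' P' + s P' ≤ c (ι P') + 2 * ∑ Q ∈ S.filter (fun Q => Q ∉ S'.image ι), (q (ι P') Q + q Q (ι P')))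
    {P₀ : β} (hP₀ : P₀ ∈ S') (hs : 1 ≤ s P₀) :
    (∑ P' ∈ S', c' P') + 2 * (∑ P' ∈ S', ∑ Q' ∈ S'.erase P', q' P' Q') < (∑ P ∈ S, c P) + 2 * ∑ P ∈ S, ∑ Q ∈ S.erase P, q P Q := by
  have h := budget_comparison S' S ι hι hinj c' s c q' q hq hc
  have h1 : s P₀ ≤ ∑ P' ∈ S', s P' := single_le_sum (fun _ _ => Nat.zero_le _) hP₀
  omega

/-- **STRICT COMPARISON FROM A DYING BRANCH**: if some branch of `S` outside the image has positive charge, the budget drops. -/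
theorem budget_lt_of_dying (S' : Finset β) (S : Finset α) (ι : β → α) (hι : ∀ P' ∈ S', ι P' ∈ S) (hinj : Set.InjOn ι S')
    (c' s : β → ℕ) (c : α → ℕ) (q' : β → β → ℕ) (q : α → α → ℕ)
    (hq : ∀ P' ∈ S', ∀ Q' ∈ S', P' ≠ Q' → q' P' Q' ≤ q (ι P') (ι Q'))
    (hc : ∀ P' ∈ S', c' P' + s P' ≤ c (ι P') + 2 * ∑ Q ∈ S.filter (fun Q => Q ∉ S'.image ι), (q (ι P') Q + q Q (ι P')))
    {Q₀ : α} (hQ₀ : Q₀ ∈ S) (hQ₀' : ∀ P' ∈ S', ι P' ≠ Q₀) (hcQ : 1 ≤ c Q₀) :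
    (∑ P' ∈ S', c' P') + 2 * (∑ P' ∈ S', ∑ Q' ∈ S'.erase P', q' P' Q') < (∑ P ∈ S, c P) + 2 * ∑ P ∈ S, ∑ Q ∈ S.erase P, q P Q := by
  have h := budget_comparison S' S ι hι hinj c' s c q' q hq hc
  have hmem : Q₀ ∈ S.filter (fun Q => Q ∉ S'.image ι) := mem_filter_not_mem_image.mpr ⟨hQ₀, hQ₀'⟩
  have h1 : c Q₀ ≤ ∑ Q ∈ S.filter (fun Q => Q ∉ S'.image ι), c Q := single_le_sum (fun _ _ => Nat.zero_le _) hmem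
  omega

/-- **NON-STRICT COMPARISON** (the succ-law shape). -/
theorem budget_le (S' : Finset β) (S : Finset α) (ι : β → α) (hι : ∀ P' ∈ S', ι P' ∈ S) (hinj : Set.InjOn ι S')
    (c' : β → ℕ) (c : α → ℕ) (q' : β → β → ℕ) (q : α → α → ℕ)
    (hq : ∀ P' ∈ S', ∀ Q' ∈ S', P' ≠ Q' → q' P' Q' ≤ q (ι P') (ι Q'))
    (hc : ∀ P' ∈ S', c' P' ≤ c (ι P') + 2 * ∑ Q ∈ S.filter (fun Q => Q ∉ S'.image ι), (q (ι P') Q + q Q (ι P'))) :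
    (∑ P' ∈ S', c' P') + 2 * (∑ P' ∈ S', ∑ Q' ∈ S'.erase P', q' P' Q') ≤ (∑ P ∈ S, c P) + 2 * ∑ P ∈ S, ∑ Q ∈ S.erase P, q P Q := by
  have h := budget_comparison S' S ι hι hinj c' (fun _ => 0) c q' q hq (fun P' hP' => by simpa using hc P' hP')
  omega

end TOT2Branch

end Summit.ResolutionOfSingularities.ResolutionOfSingularities.Theorems
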